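import Mathlib
import HarnessLib
import Summits.AtomisticToContinuum.FouriersLaw.Theses.JunctionLocality
import Summits.AtomisticToContinuum.FouriersLaw.Theorems.JunctionLocalityConductanceLowerBoundStubFisherSquare
import Summits.AtomisticToContinuum.FouriersLaw.Theorems.JunctionLocalitySuperadditiveResistanceKuboGauss
import Summits.AtomisticToContinuum.FouriersLaw.Theorems.JunctionLocalitySuperadditiveResistancePlainAdjoint

/-!
# Bulk orthogonality of floor certificates (crux stmt-AtomisticToContinuum-11749, line `ForecastSensitivitySketch`)

Helper file (`--supports stmt-AtomisticToContinuum-11749`, lead c5).  Setting as in `…CertificatePairingEnergy`: `pinnedChain ω₂ lam β γ`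
(`ω₂ > 0`, `lam, β ≥ 0`), `T > 0`, `L ≥ 2`, `μ_T = gibbsMeasure L T`, `S_B` the two contact thermostats, `X_H = liouvilleOp`; an admissible pair
`(φ, χ)` satisfies `γ S_B φ + X_H χ = −(p_0² − T)` pointwise.

`certificate_bulkOrthogonality` — the THIRD exact constraint on admissible pairs (after the two pairing identities): for every BULK OBSERVABLE
`m ∈ C²` — one with `∂_{p_0} m ≡ ∂_{p_{L−1}} m ≡ 0`, `m, X_H m ∈ L²(μ_T)` — the transport component is orthogonal to its Liouville image:

  `⟨χ, X_H m⟩_{μ_T} = 0`,   equivalently   `⟨X_H χ, m⟩ = 0`  (first-order bulk stationarity of `χ`).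

Reason: `γ S_B φ` and `p_0² − T` both have zero conditional mean over the two contact Maxwellians, so `X_H χ` has too; in the proof this is
the cut-off pairing of the constraint with `m` (`integral_chi_mul_bathOp` with `∂_b m = 0`, `integral_chi_liouville_antisymm`, and
`∫ (p_0² − T) m e^{−H/T} = T ∫ p_0 ∂_{p_0} m e^{−H/T} = 0` by `gauss_ibp`).  Consequences for certificate design (docstring of the theorem):
local-equilibrium profiles `χ = Σ_y θ_y e_y` are NOT admissible transport components unless `θ` is constant on the interior, since
`X_H` of a bulk energy profile is a non-trivial combination of bond currents; together with `…CertificateObstruction` (far loading of `φ`,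
reversal-odd `χ`) and `…CertificateLoadingBounds` this types the "admissibility wall" of the inf-side principle (lead c3 M3 / strategist S4).
No new definitions, no named facts, no sorry.  References: Bernardin–Olla 2011 §6 (admissible class `ker Ā ⊕ boundary`); folklore.
-/

noncomputable section

open MeasureTheory Filter Topology
open scoped ContDiff
open Literature.MathematicalPhysics.KineticTheory.HeatConduction
open Summit.AtomisticToContinuum.FouriersLaw.Theorems.SuperadditiveResistance.DeviceLiouville
  (kin kin_eq_sq continuous_kin liouvilleOp bathOp continuous_liouvilleOp continuous_bathOp)
open Summit.AtomisticToContinuum.FouriersLaw.Theorems.SuperadditiveResistance.Kubo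
  (chi contDiff_chi hasCompactSupport_chi tendsto_integral_chi_mul tendsto_integral_partialP_chi_mul
    integral_chi_mul_bathOp integral_chi_liouville_antisymm
    integrable_mul_mul_gibbsDensity memLp_momentum memLp_kinetic gauss_ibp)

namespace Summit.AtomisticToContinuum.FouriersLaw.Cruxes.ConductanceLowerBound.ForecastSensitivity

variable {ω₂ lam β γ T : ℝ}

/-- **Bulk orthogonality (Lebesgue form).**  For an admissible pair `(φ, χ)` (`χ ∈ L²(μ_T)`) of the `L`-chain (`L ≥ 2`) and a bulk
observable `m ∈ C²` (`∂_{p_0}m ≡ ∂_{p_{L−1}}m ≡ 0`, `m, X_H m ∈ L²(μ_T)`): `∫ χ · X_H m · e^{−H/T} = 0`. [folklore] -/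
theorem certificate_bulkOrthogonality_density (hω : 0 < ω₂) (hl : 0 ≤ lam) (hβ : 0 ≤ β) (hT : 0 < T)
    {L : ℕ} (hL : 2 ≤ L) {φ χ m : PhaseSpace L → ℝ} (hφ : ContDiff ℝ 2 φ) (hχ : ContDiff ℝ 2 χ) (hm : ContDiff ℝ 2 m)
    (hφ0 : MemLp (partialP (⟨0, by omega⟩ : Fin L) φ) 2 ((pinnedChain ω₂ lam β γ).gibbsMeasure L T))
    (hφR : MemLp (partialP (⟨L - 1, by omega⟩ : Fin L) φ) 2 ((pinnedChain ω₂ lam β γ).gibbsMeasure L T))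
    (hχ2 : MemLp χ 2 ((pinnedChain ω₂ lam β γ).gibbsMeasure L T))
    (hm2 : MemLp m 2 ((pinnedChain ω₂ lam β γ).gibbsMeasure L T))
    (hXm2 : MemLp (liouvilleOp (pinnedChain ω₂ lam β γ) L m) 2 ((pinnedChain ω₂ lam β γ).gibbsMeasure L T))
    (hm0 : ∀ x, partialP (⟨0, by omega⟩ : Fin L) m x = 0) (hmR : ∀ x, partialP (⟨L - 1, by omega⟩ : Fin L) m x = 0)
    (hpair : ∀ x, γ * bathOp L (OscillatorChain.bathWeight L) T φ x +
      liouvilleOp (pinnedChain ω₂ lam β γ) L χ x = -(kin L 0 x - T)) :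
    ∫ x, χ x * liouvilleOp (pinnedChain ω₂ lam β γ) L m x * (pinnedChain ω₂ lam β γ).gibbsDensity L T x = 0 := by
  have hL0 : 0 < L := by omega
  have hL1 : L - 1 < L := by omega
  set B := OscillatorChain.bathWeight L with hB
  set i0 : Fin L := ⟨0, hL0⟩ with hi0
  set iR : Fin L := ⟨L - 1, hL1⟩ with hiR
  have hTne : T ≠ 0 := hT.ne'
  have hU := pinnedChain_contDiff_U ω₂ lam β γ (n := ∞)
  have hV := pinnedChain_contDiff_V ω₂ lam β γ (n := ∞)
  have hHs : ContDiff ℝ ∞ ((pinnedChain ω₂ lam β γ).hamiltonian L) := (pinnedChain ω₂ lam β γ).contDiff_hamiltonian hU hV L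
  have hρc : Continuous ((pinnedChain ω₂ lam β γ).gibbsDensity L T) := pinnedChain_continuous_gibbsDensity ω₂ lam β γ L T
  have hφ1 : ContDiff ℝ 1 φ := hφ.of_le (by norm_cast)
  have hχ1 : ContDiff ℝ 1 χ := hχ.of_le (by norm_cast)
  have hm1 : ContDiff ℝ 1 m := hm.of_le (by norm_cast)
  have hχc : Continuous χ := hχ.continuous
  have hmc : Continuous m := hm.continuous
  have hdφc : ∀ i, Continuous (partialP i φ) := fun i => continuous_partialP hφ1 one_ne_zero i
  have hkc : Continuous (fun x : PhaseSpace L => kin L 0 x - T) := (continuous_kin 0).sub continuous_const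
  have hχs : ∀ n, ContDiff ℝ ∞ (chi (pinnedChain ω₂ lam β γ) L n) := fun n => contDiff_chi hHs n
  have hχnc : ∀ n, Continuous (chi (pinnedChain ω₂ lam β γ) L n) := fun n => (hχs n).continuous
  have hχncs : ∀ n, HasCompactSupport (chi (pinnedChain ω₂ lam β γ) L n) := fun n =>
    hasCompactSupport_chi hω hl hβ γ L n
  have hdχnc : ∀ n i, Continuous (partialP i (chi (pinnedChain ω₂ lam β γ) L n)) := fun n i =>
    continuous_partialP ((hχs n).of_le (by norm_cast)) one_ne_zero i
  have hXχc : Continuous (liouvilleOp (pinnedChain ω₂ lam β γ) L χ) :=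
    continuous_liouvilleOp (pinnedChain ω₂ lam β γ) (hU.of_le (by norm_cast)) (hV.of_le (by norm_cast)) hχ1
  have hXmc : Continuous (liouvilleOp (pinnedChain ω₂ lam β γ) L m) :=
    continuous_liouvilleOp (pinnedChain ω₂ lam β γ) (hU.of_le (by norm_cast)) (hV.of_le (by norm_cast)) hm1
  have hSφc : Continuous (bathOp L B T φ) := continuous_bathOp hφ B T
  -- the identity at cutoff level n
  have hlevel : ∀ n : ℕ,
      γ * (-T * ∑ i, B i * ((∫ x, chi (pinnedChain ω₂ lam β γ) L n x * partialP i m x * partialP i φ x *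
          (pinnedChain ω₂ lam β γ).gibbsDensity L T x) +
        ∫ x, m x * partialP i (chi (pinnedChain ω₂ lam β γ) L n) x * partialP i φ x *
          (pinnedChain ω₂ lam β γ).gibbsDensity L T x)) -
        ∫ x, chi (pinnedChain ω₂ lam β γ) L n x * χ x * liouvilleOp (pinnedChain ω₂ lam β γ) L m x *
          (pinnedChain ω₂ lam β γ).gibbsDensity L T x =
      -∫ x, chi (pinnedChain ω₂ lam β γ) L n x * m x * (kin L 0 x - T) * (pinnedChain ω₂ lam β γ).gibbsDensity L T x := by
    intro n
    have hbath := integral_chi_mul_bathOp hω hl hβ γ L B hTne hm hφ n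
    have hanti := integral_chi_liouville_antisymm hω hl hβ γ L hTne hm hχ n
    have hIX : Integrable fun x => chi (pinnedChain ω₂ lam β γ) L n x * χ x *
        liouvilleOp (pinnedChain ω₂ lam β γ) L m x * (pinnedChain ω₂ lam β γ).gibbsDensity L T x :=
      Continuous.integrable_of_hasCompactSupport (by fun_prop) (((hχncs n).mul_right).mul_right.mul_right)
    have hI2 : Integrable fun x => chi (pinnedChain ω₂ lam β γ) L n x * m x *
        liouvilleOp (pinnedChain ω₂ lam β γ) L χ x * (pinnedChain ω₂ lam β γ).gibbsDensity L T x :=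
      Continuous.integrable_of_hasCompactSupport (by fun_prop) (((hχncs n).mul_right).mul_right.mul_right)
    have hX : ∫ x, chi (pinnedChain ω₂ lam β γ) L n x * m x * liouvilleOp (pinnedChain ω₂ lam β γ) L χ x *
        (pinnedChain ω₂ lam β γ).gibbsDensity L T x =
        -∫ x, chi (pinnedChain ω₂ lam β γ) L n x * χ x * liouvilleOp (pinnedChain ω₂ lam β γ) L m x *
          (pinnedChain ω₂ lam β γ).gibbsDensity L T x := by
      have h0 : (∫ x, chi (pinnedChain ω₂ lam β γ) L n x * m x * liouvilleOp (pinnedChain ω₂ lam β γ) L χ x *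
          (pinnedChain ω₂ lam β γ).gibbsDensity L T x) +
          ∫ x, chi (pinnedChain ω₂ lam β γ) L n x * χ x * liouvilleOp (pinnedChain ω₂ lam β γ) L m x *
            (pinnedChain ω₂ lam β γ).gibbsDensity L T x = 0 := by
        rw [← integral_add hI2 hIX, ← hanti]
        exact integral_congr_ae (ae_of_all _ fun x => by ring)
      linarith
    have hI1 : Integrable fun x => chi (pinnedChain ω₂ lam β γ) L n x * m x * bathOp L B T φ x *
        (pinnedChain ω₂ lam β γ).gibbsDensity L T x :=
      Continuous.integrable_of_hasCompactSupport (by fun_prop) (((hχncs n).mul_right).mul_right.mul_right)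
    have hsum : γ * (∫ x, chi (pinnedChain ω₂ lam β γ) L n x * m x * bathOp L B T φ x *
        (pinnedChain ω₂ lam β γ).gibbsDensity L T x) +
        ∫ x, chi (pinnedChain ω₂ lam β γ) L n x * m x * liouvilleOp (pinnedChain ω₂ lam β γ) L χ x *
          (pinnedChain ω₂ lam β γ).gibbsDensity L T x =
        -∫ x, chi (pinnedChain ω₂ lam β γ) L n x * m x * (kin L 0 x - T) * (pinnedChain ω₂ lam β γ).gibbsDensity L T x := by
      rw [← integral_const_mul, ← integral_add (hI1.const_mul γ) hI2, ← integral_neg]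
      refine integral_congr_ae (ae_of_all _ fun x => ?_)
      have := hpair x
      calc γ * (chi (pinnedChain ω₂ lam β γ) L n x * m x * bathOp L B T φ x * (pinnedChain ω₂ lam β γ).gibbsDensity L T x) +
          chi (pinnedChain ω₂ lam β γ) L n x * m x * liouvilleOp (pinnedChain ω₂ lam β γ) L χ x *
            (pinnedChain ω₂ lam β γ).gibbsDensity L T x
          = chi (pinnedChain ω₂ lam β γ) L n x * m x * (γ * bathOp L B T φ x + liouvilleOp (pinnedChain ω₂ lam β γ) L χ x) *
            (pinnedChain ω₂ lam β γ).gibbsDensity L T x := by ring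
        _ = chi (pinnedChain ω₂ lam β γ) L n x * m x * (-(kin L 0 x - T)) * (pinnedChain ω₂ lam β γ).gibbsDensity L T x := by
            rw [this]
        _ = -(chi (pinnedChain ω₂ lam β γ) L n x * m x * (kin L 0 x - T) * (pinnedChain ω₂ lam β γ).gibbsDensity L T x) := by
            ring
    rw [hX, hbath] at hsum
    linarith [hsum]
  -- the main bath terms vanish (∂_b m ≡ 0) and the sum collapses to the two cutoff-gradient terms
  have hlevel' : ∀ n : ℕ,
      -(γ * T) * (((0 : ℝ) + ∫ x, m x * partialP i0 (chi (pinnedChain ω₂ lam β γ) L n) x * partialP i0 φ x *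
          (pinnedChain ω₂ lam β γ).gibbsDensity L T x) +
        ((0 : ℝ) + ∫ x, m x * partialP iR (chi (pinnedChain ω₂ lam β γ) L n) x * partialP iR φ x *
          (pinnedChain ω₂ lam β γ).gibbsDensity L T x)) -
        ∫ x, chi (pinnedChain ω₂ lam β γ) L n x * χ x * liouvilleOp (pinnedChain ω₂ lam β γ) L m x *
          (pinnedChain ω₂ lam β γ).gibbsDensity L T x =
      -∫ x, chi (pinnedChain ω₂ lam β γ) L n x * m x * (kin L 0 x - T) * (pinnedChain ω₂ lam β γ).gibbsDensity L T x := by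
    intro n
    rw [← hlevel n, sum_bathWeight_mul' _ (b₀ := i0) (b₁ := iR) rfl rfl]
    have e0 : ∫ x, chi (pinnedChain ω₂ lam β γ) L n x * partialP i0 m x * partialP i0 φ x *
        (pinnedChain ω₂ lam β γ).gibbsDensity L T x = 0 := by
      rw [← integral_zero]
      exact integral_congr_ae (ae_of_all _ fun x => by dsimp only; rw [hm0 x]; ring)
    have eR : ∫ x, chi (pinnedChain ω₂ lam β γ) L n x * partialP iR m x * partialP iR φ x *
        (pinnedChain ω₂ lam β γ).gibbsDensity L T x = 0 := by
      rw [← integral_zero]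
      exact integral_congr_ae (ae_of_all _ fun x => by dsimp only; rw [hmR x]; ring)
    rw [e0, eR]
    ring
  -- limits
  have hlimB : ∀ {i : Fin L}, MemLp (partialP i φ) 2 ((pinnedChain ω₂ lam β γ).gibbsMeasure L T) →
      Tendsto (fun n : ℕ => ∫ x, m x * partialP i (chi (pinnedChain ω₂ lam β γ) L n) x * partialP i φ x *
        (pinnedChain ω₂ lam β γ).gibbsDensity L T x) atTop (𝓝 0) := by
    intro i hi
    have hF : Integrable fun x => m x * partialP i φ x * (pinnedChain ω₂ lam β γ).gibbsDensity L T x :=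
      integrable_mul_mul_gibbsDensity hω hl hβ γ L hT hm2 hi
    refine (tendsto_integral_partialP_chi_mul hω hl hβ γ L T i (F := fun x => m x * partialP i φ x)
      (by fun_prop) hF).congr fun n => ?_
    exact integral_congr_ae (ae_of_all _ fun x => by ring)
  have hlimX : Tendsto (fun n : ℕ => ∫ x, chi (pinnedChain ω₂ lam β γ) L n x * χ x *
      liouvilleOp (pinnedChain ω₂ lam β γ) L m x * (pinnedChain ω₂ lam β γ).gibbsDensity L T x) atTop
      (𝓝 (∫ x, χ x * liouvilleOp (pinnedChain ω₂ lam β γ) L m x * (pinnedChain ω₂ lam β γ).gibbsDensity L T x)) := by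
    have hF : Integrable fun x => χ x * liouvilleOp (pinnedChain ω₂ lam β γ) L m x * (pinnedChain ω₂ lam β γ).gibbsDensity L T x :=
      integrable_mul_mul_gibbsDensity hω hl hβ γ L hT hχ2 hXm2
    refine (tendsto_integral_chi_mul hω.le hl hβ γ L T (F := fun x => χ x * liouvilleOp (pinnedChain ω₂ lam β γ) L m x)
      (by fun_prop) hF).congr fun n => ?_
    exact integral_congr_ae (ae_of_all _ fun x => by ring)
  -- the source pairs to zero with a bulk observable: ∫ (p_0² − T) m ρ = T ∫ p_0 ∂_{p_0} m ρ = 0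
  have hk2 : MemLp (fun x : PhaseSpace L => kin L 0 x - T) 2 ((pinnedChain ω₂ lam β γ).gibbsMeasure L T) :=
    (memLp_kinetic hω hl hβ L hT i0).ae_eq (ae_of_all _ fun x => by simp only [kin_eq_sq hL0]; rfl)
  have hsrc : ∫ x, m x * (kin L 0 x - T) * (pinnedChain ω₂ lam β γ).gibbsDensity L T x = 0 := by
    have hdm : MemLp (partialP i0 m) 2 ((pinnedChain ω₂ lam β γ).gibbsMeasure L T) := by
      have hz : partialP i0 m = fun _ => 0 := funext hm0
      haveI := pinnedChain_isProbabilityMeasure_gibbsMeasure hω hl hβ γ L hT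
      rw [hz]; exact memLp_const 0
    have h := gauss_ibp hω hl hβ L hT i0 hm1 hm2 hdm
    have e1 : ∫ x, m x * (kin L 0 x - T) * (pinnedChain ω₂ lam β γ).gibbsDensity L T x =
        ∫ x, (x.2 i0 ^ 2 - T) * m x * (pinnedChain ω₂ lam β γ).gibbsDensity L T x :=
      integral_congr_ae (ae_of_all _ fun x => by simp only [kin_eq_sq hL0]; show m x * (x.2 ⟨0, hL0⟩ ^ 2 - T) * _ = _; ring)
    rw [e1, h]
    simp only [hm0, mul_zero, zero_mul, integral_zero, mul_zero]
  have hlimS : Tendsto (fun n : ℕ => ∫ x, chi (pinnedChain ω₂ lam β γ) L n x * m x * (kin L 0 x - T) *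
      (pinnedChain ω₂ lam β γ).gibbsDensity L T x) atTop (𝓝 0) := by
    have hF : Integrable fun x => m x * (kin L 0 x - T) * (pinnedChain ω₂ lam β γ).gibbsDensity L T x :=
      integrable_mul_mul_gibbsDensity hω hl hβ γ L hT hm2 hk2
    have h := tendsto_integral_chi_mul hω.le hl hβ γ L T (F := fun x => m x * (kin L 0 x - T)) (by fun_prop) hF
    rw [hsrc] at h
    refine h.congr fun n => integral_congr_ae (ae_of_all _ fun x => by ring)
  have h0 : Tendsto (fun _ : ℕ => (0 : ℝ)) atTop (𝓝 0) := tendsto_const_nhds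
  have hLHS := (((h0.add (hlimB hφ0)).add (h0.add (hlimB hφR))).const_mul (-(γ * T))).sub hlimX
  have heq := tendsto_nhds_unique (hLHS.congr hlevel') hlimS.neg
  simp only [add_zero, neg_zero, mul_zero, zero_sub] at heq
  linarith

/-- **BULK ORTHOGONALITY of floor certificates.**  For `L ≥ 2`, every admissible pair `(φ, χ)` with `χ ∈ L²(μ_T)` and every bulk observable
`m ∈ C²` (`∂_{p_0} m ≡ ∂_{p_{L−1}} m ≡ 0`; `m, X_H m ∈ L²(μ_T)`): `⟨χ, X_H m⟩_{μ_T} = 0` — the transport component of a certificate is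
first-order bulk-stationary.  Consequence: a local-equilibrium profile `χ = Σ_y θ_y e_y` (or any `χ` whose `X_H`-pairing with some bulk
observable is non-zero) is never the transport component of an admissible pair; only genuinely dynamical (resolvent-like) objects are. [folklore] -/
theorem certificate_bulkOrthogonality (hω : 0 < ω₂) (hl : 0 ≤ lam) (hβ : 0 ≤ β) (hT : 0 < T)
    {L : ℕ} (hL : 2 ≤ L) {φ χ m : PhaseSpace L → ℝ} (hφ : ContDiff ℝ 2 φ) (hχ : ContDiff ℝ 2 χ) (hm : ContDiff ℝ 2 m)
    (hφ0 : MemLp (partialP (⟨0, by omega⟩ : Fin L) φ) 2 ((pinnedChain ω₂ lam β γ).gibbsMeasure L T))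
    (hφR : MemLp (partialP (⟨L - 1, by omega⟩ : Fin L) φ) 2 ((pinnedChain ω₂ lam β γ).gibbsMeasure L T))
    (hχ2 : MemLp χ 2 ((pinnedChain ω₂ lam β γ).gibbsMeasure L T))
    (hm2 : MemLp m 2 ((pinnedChain ω₂ lam β γ).gibbsMeasure L T))
    (hXm2 : MemLp (liouvilleOp (pinnedChain ω₂ lam β γ) L m) 2 ((pinnedChain ω₂ lam β γ).gibbsMeasure L T))
    (hm0 : ∀ x, partialP (⟨0, by omega⟩ : Fin L) m x = 0) (hmR : ∀ x, partialP (⟨L - 1, by omega⟩ : Fin L) m x = 0)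
    (hpair : ∀ x, γ * bathOp L (OscillatorChain.bathWeight L) T φ x +
      liouvilleOp (pinnedChain ω₂ lam β γ) L χ x = -(kin L 0 x - T)) :
    ∫ x, χ x * liouvilleOp (pinnedChain ω₂ lam β γ) L m x ∂((pinnedChain ω₂ lam β γ).gibbsMeasure L T) = 0 := by
  rw [OscillatorChain.integral_gibbsMeasure,
    certificate_bulkOrthogonality_density hω hl hβ hT hL hφ hχ hm hφ0 hφR hχ2 hm2 hXm2 hm0 hmR hpair, mul_zero]

/-- Registered helper sub-goal `helper_certificateBulkOrthogonality` of stub `stub_transmissionGradientFloor`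
(= `certificate_bulkOrthogonality` in closed form; line ForecastSensitivitySketch, crux stmt-AtomisticToContinuum-11749). [folklore] -/
theorem helper_certificateBulkOrthogonality : ∀ {ω₂ lam β γ T : ℝ}, 0 < ω₂ → 0 ≤ lam → 0 ≤ β → 0 < T → ∀ {L : ℕ} (hL : 2 ≤ L) {φ χ m : PhaseSpace L → ℝ}, ContDiff ℝ 2 φ → ContDiff ℝ 2 χ → ContDiff ℝ 2 m → MemLp (partialP (⟨0, by omega⟩ : Fin L) φ) 2 ((pinnedChain ω₂ lam β γ).gibbsMeasure L T) → MemLp (partialP (⟨L - 1, by omega⟩ : Fin L) φ) 2 ((pinnedChain ω₂ lam β γ).gibbsMeasure L T) → MemLp χ 2 ((pinnedChain ω₂ lam β γ).gibbsMeasure L T) → MemLp m 2 ((pinnedChain ω₂ lam β γ).gibbsMeasure L T) → MemLp (liouvilleOp (pinnedChain ω₂ lam β γ) L m) 2 ((pinnedChain ω₂ lam β γ).gibbsMeasure L T) → (∀ x, partialP (⟨0, by omega⟩ : Fin L) m x = 0) → (∀ x, partialP (⟨L - 1, by omega⟩ : Fin L) m x = 0) → (∀ x, γ * bathOp L (OscillatorChain.bathWeight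 L) T φ x + liouvilleOp (pinnedChain ω₂ lam β γ) L χ x = -(kin L 0 x - T)) → ∫ x, χ x * liouvilleOp (pinnedChain ω₂ lam β γ) L m x ∂((pinnedChain ω₂ lam β γ).gibbsMeasure L T) = 0 :=
  @certificate_bulkOrthogonality

end Summit.AtomisticToContinuum.FouriersLaw.Cruxes.ConductanceLowerBound.ForecastSensitivity

end
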